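import Summits.ResolutionOfSingularities.ResolutionOfSingularities.Theorems.RadicialJungCleanModelsLocalMonomializationAlongCoarsening
import Summits.ResolutionOfSingularities.ResolutionOfSingularities.Theorems.RadicialJungCleanModelsWeakEmbeddedLUDimLEThree
import Summits.ResolutionOfSingularities.ResolutionOfSingularities.Theorems.RadicialJungCleanModelsCcurveRebaseField
import Summits.ResolutionOfSingularities.ResolutionOfSingularities.Theorems.RadicialJungCleanModelsCcurveCoarseCentre
import Literature.AlgebraicGeometry.Resolution.AffineDomainDimension
import HarnessLib

/-!
# Weak embedded local uniformization along every PROPER COARSENING of a valuation of a function field of transcendence degree `≤ 4`, realised inside the finer valuation ring — modulo F-02 + F-32 (step (i) of the rank-one reduction of `hMono_4`)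

Route `RadicialJung`, crux `CleanModels` (stmt-ResolutionOfSingularities-15917), registered skeleton `Cruxes/CleanModels/Lines/Sketch.lean`
rev 35 (sha16 de44649d8f729c3b), stub 7 `stub_cleanModelsDimGEFour`.  Explicit-unit seat `decomp-res-hand-2` g4 (structural hand); memo
`Cruxes/CleanModels/Lines/Sketch-memo-hand2-g4-stubs-5-7.md` §2 (step (i)) and §5 item 2.  OURS; structural bookkeeping, counted 0; nothing here
proves resolution of singularities in characteristic `p`.

`weakEmbeddedLU_along_properCoarsening_dimLEFour` — for valuation rings `O < O₁` of a field `K ⊇ k` (a PROPER coarsening: `O ≤ O₁`,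
`O₁ ≠ O`), a finitely generated model `A ⊆ O` with `Frac A = K` and `dim A ≤ 4` (NO regularity, NO zero-dimensionality, any rank), and a finite
`Z ⊆ A`: there is a finitely generated `A ≤ A₂ ⊆ O` (inside the FINER ring) whose local ring at the centre of `O₁` is regular, with a regular
system of parameters in which every non-zero `z ∈ Z` is a unit times a monomial.  Proof (Novacoski–Spivakovsky 2012 §3.2 step (i), made PRINT in
dimension 4 by REBASING): pick `t ∈ 𝔪_O` with `ν₁(t) = 1` (✓ `Ccurve.exists_mem_maximalIdeal_valuation_eq_one`, as `O₁ ≠ O`); `t` is residually transcendental for `O₁` (✓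
`Ccurve.valuation_aeval_eq_one`), so `F = k⟮t⟯ ⊆ locAtCentre A[t] O₁` (✓ `Ccurve.mem_locAtCentre_of_mem_adjoin_simple`) and `trdeg_F K ≤ 3`
(`trdeg_k F ≥ 1`, tower law); weak embedded LU in dimension `≤ 3` over `F` along `O₁` (✓ `weakEmbeddedLU_dimLEThree_of_cossartPiltant2019`, F-02 +
F-32, arbitrary models); descend the `F`-model to a `k`-model with the same local ring at the centre of `O₁`; realise it inside `O` by the
Cor. 2.14 device (✓ `exists_model_le_of_model_le_coarsening`).
[cite: NovacoskiSpivakovsky2014, §3.2 and Cor. 2.14] [cite: CossartPiltant2019, Thm. 1.1] [cite: CossartJannsenSaito2020, Cor. 1.5]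
-/

noncomputable section

set_option linter.dupNamespace false -- mandated namespace of this single-conjunct summit

open IsLocalRing AlgebraicGeometry CategoryTheory Polynomial
open Literature.AlgebraicGeometry.Resolution Literature.AlgebraicGeometry.Motives

namespace Summit.ResolutionOfSingularities.ResolutionOfSingularities.Theorems.RadicialJung.CleanModels

variable {k K : Type} [Field k] [Field K] [Algebra k K]

/-- For an intermediate field `F` of `K/k` and a finitely generated `k`-subalgebra `A` with `Frac A = K` and `dim A ≤ N + 1`, if `F` contains an
element transcendental over `k` then `trdeg_F K ≤ N` (tower law `trdeg_k F + trdeg_F K = trdeg_k K = dim A`). [folklore] -/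
theorem trdeg_le_of_transcendental_mem (F : IntermediateField k K) {t : F} (ht : Transcendental k t)
    (A : Subalgebra k K) (hAfg : A.FG) [IsFractionRing A K] {N : ℕ} (hdimA : ringKrullDim A ≤ (N + 1 : ℕ)) :
    Algebra.trdeg F K ≤ N := by
  haveI : Algebra.FiniteType k A := A.fg_iff_finiteType.mp hAfg
  obtain ⟨n, hn, htr⟩ := exists_ringKrullDim_eq_and_trdeg_eq k A
  have hnN : n ≤ N + 1 := by rw [hn] at hdimA; exact_mod_cast hdimA
  have hK : Algebra.trdeg k K = n := by rw [trdeg_eq_trdeg_of_isFractionRing A, htr]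
  have htower : Algebra.trdeg k F + Algebra.trdeg F K = Algebra.trdeg k K := trdeg_add_eq k F (A := K)
  haveI : Algebra.Transcendental k F := ⟨⟨t, ht⟩⟩
  have hpos : 1 ≤ Algebra.trdeg k F := Cardinal.one_le_iff_pos.mpr (trdeg_pos k F)
  -- everything is finite
  have hFle : Algebra.trdeg F K ≤ n := by rw [← hK, ← htower]; exact le_add_self
  have hkFle : Algebra.trdeg k F ≤ n := by rw [← hK, ← htower]; exact le_self_add
  obtain ⟨a, ha⟩ := Cardinal.lt_aleph0.mp (lt_of_le_of_lt hkFle (Cardinal.natCast_lt_aleph0 (n := n)))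
  obtain ⟨b, hb⟩ := Cardinal.lt_aleph0.mp (lt_of_le_of_lt hFle (Cardinal.natCast_lt_aleph0 (n := n)))
  rw [ha, hb, hK] at htower
  rw [ha] at hpos
  rw [hb]
  have hab : a + b = n := by exact_mod_cast htower
  have ha1 : 1 ≤ a := by exact_mod_cast hpos
  have : b ≤ N := by omega
  exact_mod_cast this

/-- **Weak embedded local uniformization along every PROPER COARSENING in transcendence degree `≤ 4`, realised inside the finer valuation ring,
modulo F-02 and F-32** — step (i) of Novacoski–Spivakovsky's rank-one reduction (2012, §3.2) for the local input `hMono_4` of stub 7, made PRINT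
by rebasing over `k⟮t⟯` for an `O₁`-unit `t ∈ 𝔪_O` (see the module docstring).  No regularity, zero-dimensionality or rank hypothesis on
`O`, `O₁`, `A`. [cite: NovacoskiSpivakovsky2014, §3.2 and Cor. 2.14] [cite: CossartPiltant2019, Thm. 1.1] [cite: CossartJannsenSaito2020, Cor. 1.5] -/
theorem weakEmbeddedLU_along_properCoarsening_dimLEFour (hCP : CossartPiltant2019.{0})
    (hEmb : ∀ (Z : Scheme.{0}) [IsIntegral Z] [IsNoetherian Z], Scheme.IsRegular Z →
      Scheme.IsExcellent Z → ∀ (X : Set Z), IsClosed X → X ≠ Set.univ → topologicalKrullDim X ≤ 2 →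
        ∃ (Z' : Scheme.{0}) (π : Z' ⟶ Z), IsProper π ∧ Function.Surjective π.base ∧
          (∃ U : Z.Opens, (U : Set Z) = Xᶜ ∧ IsIso (π ∣_ U)) ∧
          IsStrictNormalCrossingsDivisor Z' (π.base ⁻¹' X))
    (O O₁ : ValuationSubring K) (hOO₁ : O ≤ O₁) (hne : O₁ ≠ O)
    (A : Subalgebra k K) (hAO : A.toSubring ≤ O.toSubring) (hAfg : A.FG) (hfrac : IsFractionRing A K)
    (hdimA : ringKrullDim A ≤ 4)
    (Z : Finset K) (hZ : ∀ z ∈ Z, z ∈ A) :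
    ∃ (A₂ : Subalgebra k K), A₂.toSubring ≤ O.toSubring ∧ A ≤ A₂ ∧ A₂.FG ∧
    ∃ (_ : IsRegularLocalRing (locAtCentre A₂.toSubring O₁)) (e : ℕ) (a : Fin e → ↥(locAtCentre A₂.toSubring O₁)),
      Ideal.span (Set.range a) = IsLocalRing.maximalIdeal ↥(locAtCentre A₂.toSubring O₁) ∧
      ringKrullDim ↥(locAtCentre A₂.toSubring O₁) = (e : WithBot ℕ∞) ∧
      ∀ z ∈ Z, z ≠ 0 → ∃ (v : ↥(locAtCentre A₂.toSubring O₁)) (μ : Fin e → ℕ), IsUnit v ∧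
        z = (v : K) * ∏ i, ((a i : ↥(locAtCentre A₂.toSubring O₁)) : K) ^ (μ i) := by
  classical
  haveI := hfrac
  -- (1) an `O₁`-unit `t` in `𝔪_O`, adjoined to the model: `B = A[t] ⊆ O`
  obtain ⟨t, htO, hvt, hv₁t⟩ := Ccurve.exists_mem_maximalIdeal_valuation_eq_one O O₁ hOO₁ hne
  let B : Subalgebra k K := Algebra.adjoin k ((A : Set K) ∪ ↑({t} : Finset K))
  have hAB : A ≤ B := fun x hx => Algebra.subset_adjoin (Or.inl hx)
  have htB : t ∈ B := Algebra.subset_adjoin (Or.inr (by simp))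
  have hk : ∀ c : k, algebraMap k K c ∈ O := fun c => hAO (A.algebraMap_mem c)
  let Ok : Subalgebra k K := ({ O.toSubring with algebraMap_mem' := hk } : Subalgebra k K)
  have hBO : B.toSubring ≤ O.toSubring := by
    have h : B ≤ Ok := Algebra.adjoin_le (by
      rintro y (hy | hy)
      · exact hAO hy
      · have : y = t := by simpa using hy
        rw [this]; exact htO)
    exact fun x hx => h hx
  have hBO₁ : B.toSubring ≤ O₁.toSubring := fun x hx => hOO₁ (hBO hx)
  have hBfg : B.FG := fg_adjoin_subalgebra_union A hAfg {t}
  haveI hfrB : IsFractionRing B K := isFractionRing_of_le hAB hfrac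
  have hdimB : ringKrullDim B ≤ 4 := by rw [ringKrullDim_eq_of_fg_of_le hAfg hBfg hAB]; exact hdimA
  -- (2) the rebasing field `F = k⟮t⟯ ⊆ locAtCentre B O₁`; `t` is transcendental over `k`
  let F : IntermediateField k K := IntermediateField.adjoin k ({t} : Set K)
  have hFloc : ∀ z : F, (z : K) ∈ locAtCentre B.toSubring O₁ := fun z =>
    Ccurve.mem_locAtCentre_of_mem_adjoin_simple O O₁ hOO₁ B hBO t htB hvt hv₁t z.2
  have htF : t ∈ F := IntermediateField.mem_adjoin_simple_self k t
  have htransK : Transcendental k t := by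
    rintro ⟨q, hq0, hq⟩
    have h1 := Ccurve.valuation_aeval_eq_one O O₁ hOO₁ B hBO t htB hvt hv₁t q hq0
    rw [hq, map_zero] at h1
    exact zero_ne_one h1
  have htransF : Transcendental k (⟨t, htF⟩ : F) := by
    have hinj : Function.Injective (algebraMap F K) := (algebraMap F K).injective
    exact (transcendental_algebraMap_iff hinj).mp htransK
  -- (3) the `F`-model `Ā = F[s]`, `B = k[s]`, with the same local ring at the centre of `O₁`
  obtain ⟨s, hs⟩ := hBfg
  let Ā : Subalgebra F K := Algebra.adjoin F (s : Set K)
  have hsĀ : ∀ x ∈ (s : Set K), x ∈ Ā := fun x hx => Algebra.subset_adjoin hx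
  have hsB : ∀ x ∈ (s : Set K), x ∈ B := fun x hx => by
    rw [← hs]; exact Algebra.subset_adjoin hx
  have hBĀ : B.toSubring ≤ Ā.toSubring := by
    intro z hz
    have hz' : z ∈ Algebra.adjoin k (s : Set K) := by rw [hs]; exact hz
    have h1 : Algebra.adjoin k (s : Set K) ≤ Ā.restrictScalars k :=
      Algebra.adjoin_le fun x hx => (Subalgebra.mem_restrictScalars k).mpr (hsĀ x hx)
    exact (Subalgebra.mem_restrictScalars k).mp (h1 hz')
  let R₀' : Subalgebra F K := { locAtCentre B.toSubring O₁ with algebraMap_mem' := fun z => hFloc z }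
  have hĀR₀ : Ā.toSubring ≤ locAtCentre B.toSubring O₁ := by
    have h1 : Ā ≤ R₀' := Algebra.adjoin_le fun x hx => le_locAtCentre _ _ (hsB x hx)
    exact fun z hz => h1 hz
  have hĀO₁ : Ā.toSubring ≤ O₁.toSubring := fun z hz => locAtCentre_le hBO₁ (hĀR₀ hz)
  have hĀfg : Ā.FG := ⟨s, rfl⟩
  haveI hfrĀ : IsFractionRing Ā K := by
    refine IsFractionRing.of_field _ K fun z => ?_
    obtain ⟨a, b, hb, hab⟩ := IsFractionRing.div_surjective (A := B) z
    exact ⟨⟨a, hBĀ a.2⟩, ⟨b, hBĀ b.2⟩, hab.symm⟩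
  -- (4) `dim Ā ≤ 3`: `trdeg_F K ≤ 3` by the tower law
  have htrF : Algebra.trdeg F K ≤ 3 := trdeg_le_of_transcendental_mem F htransF B ⟨s, hs⟩ (N := 3) (by exact_mod_cast hdimB)
  have hdimĀ : ringKrullDim Ā ≤ 3 := by exact_mod_cast ringKrullDim_le_of_fg_of_trdeg_le Ā hĀfg htrF
  -- (5) weak embedded LU in dimension `≤ 3` over `F`, along `O₁`
  have hZĀ : ∀ z ∈ Z, z ∈ Ā := fun z hz => hBĀ (hAB (hZ z hz))
  obtain ⟨Ā', hĀ'O₁, hĀĀ', hĀ'fg, hreg', e, a, ha, hdim', hmono⟩ :=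
    weakEmbeddedLU_dimLEThree_of_cossartPiltant2019 hCP hEmb F K O₁ Ā hĀO₁ hĀfg hfrĀ hdimĀ Z hZĀ
  -- (6) descend to the `k`-model `A₁ = k[B ∪ G]`, `Ā' = F[G]`, with the same local ring at the centre of `O₁`
  obtain ⟨G, hG⟩ := hĀ'fg
  let A₁ : Subalgebra k K := Algebra.adjoin k ((B : Set K) ∪ ↑G)
  have hBA₁ : B ≤ A₁ := fun x hx => Algebra.subset_adjoin (Or.inl hx)
  have hA₁fg : A₁.FG := fg_adjoin_subalgebra_union B ⟨s, hs⟩ G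
  have hGĀ' : ∀ g ∈ (G : Set K), g ∈ Ā' := fun g hg => (hG ▸ Algebra.subset_adjoin hg : g ∈ Ā')
  have hA₁Ā' : A₁.toSubring ≤ Ā'.toSubring := by
    have h1 : A₁ ≤ Ā'.restrictScalars k := by
      refine Algebra.adjoin_le ?_
      rintro y (hy | hy)
      · exact (Subalgebra.mem_restrictScalars k).mpr (hĀĀ' (hBĀ hy))
      · exact (Subalgebra.mem_restrictScalars k).mpr (hGĀ' y hy)
    exact fun x hx => (Subalgebra.mem_restrictScalars k).mp (h1 hx)
  have hA₁O₁ : A₁.toSubring ≤ O₁.toSubring := fun x hx => hĀ'O₁ (hA₁Ā' hx)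
  have hFloc₁ : ∀ z : F, (z : K) ∈ locAtCentre A₁.toSubring O₁ := fun z =>
    locAtCentre_mono O₁ (show B.toSubring ≤ A₁.toSubring from fun x hx => hBA₁ hx) (hFloc z)
  let L₁ : Subalgebra F K := { locAtCentre A₁.toSubring O₁ with algebraMap_mem' := fun z => hFloc₁ z }
  have hĀ'L₁ : Ā'.toSubring ≤ locAtCentre A₁.toSubring O₁ := by
    have h1 : Ā' ≤ L₁ := by
      rw [← hG]
      exact Algebra.adjoin_le fun g hg => le_locAtCentre _ _ (Algebra.subset_adjoin (Or.inr hg))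
    exact fun x hx => h1 hx
  have hloc : locAtCentre Ā'.toSubring O₁ = locAtCentre A₁.toSubring O₁ :=
    (locAtCentre_eq_of_mutual_le O₁ A₁.toSubring Ā'.toSubring (hA₁Ā'.trans (le_locAtCentre _ _)) hĀ'L₁).symm
  -- (7) realise inside `O` with the same local ring at the centre of `O₁`
  obtain ⟨A₂, hA₂O, hAA₂, hA₂fg, heq⟩ :=
    exists_model_le_of_model_le_coarsening O O₁ hOO₁ A hAO hAfg A₁ hA₁O₁ (hAB.trans hBA₁) hA₁fg
  refine ⟨A₂, hA₂O, hAA₂, hA₂fg, ?_⟩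
  rw [heq, ← hloc]
  exact ⟨hreg', e, a, ha, hdim', hmono⟩

end Summit.ResolutionOfSingularities.ResolutionOfSingularities.Theorems.RadicialJung.CleanModels

end
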